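import Mathlib
import HarnessLib
import Summits.NavierStokesRegularity.NavierStokesRegularity.Theorems.ChiralWindowDoorDefs
import Summits.NavierStokesRegularity.NavierStokesRegularity.Theorems.ChiralWindowDoorLambda
import Summits.NavierStokesRegularity.NavierStokesRegularity.Theorems.ChiralWindowDoorZoomLambdaTools

/-!
# Door S20 «ChiralWindowDoor» — tools for the zoom crux K1 (continued): integrability of the `Λ`-integrand from
# near/tail control, tails of bounded fields, the `L²` mass of a zoomed slice

Door S20 of nsreg-p1's local Type-I door family (DESIGN-ONLY, route NOT born).  Three more pure-analysis lemmas for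
the three-zone passage of `Λ = (−Δ)^{1/2}` along the parabolic point zoom (`…ZoomLambdaTools`, `…ZoomLambdaLimit`):

* `integrable_fracLapHalf_integrand_of_near_of_tails` — the `Λ`-integrand `lamK z • (2f(y) − f(y+z) − f(y−z))` is
  integrable as soon as the second differences are `O(‖z‖²)` near `0` and the two shifted tails
  `lamK(z)‖f(y ± z)‖` are integrable off a ball;
* `integrableOn_tail_of_bounded` — for a bounded field the shifted tails are integrable with
  `∫_{‖z‖≥L} lamK‖f(y±z)‖ ≤ B c/L` (`c` the packaged tail constant of `exists_lamK_tail_const`);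
* `integral_normSq_zoomSlice` — `∫‖c • u(x₀ + μ w)‖² dw = c² μ⁻³ ∫‖u‖²` (`μ > 0`), with integrability;
* `integrable_normSq_comp_neg`, `integral_tail_shift_neg_le` — the `y − z` tail from the `y + z` one;
* `setIntegral_tail_secondDiff_le`, `far_error_le` — bookkeeping: tail of the `Λ`-integrand from the two shifted tails; the
  far-field error is `O(μ²)`.

Seat nsreg-p6 g12 (THEOREMS-ONLY door sequels, DIRECTOR-NS g8 #32 (2)/#36).  WHAT THIS IS NOT: not NS regularity
(Clay A); analysis tools; no route is opened.
-/

noncomputable section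

-- the summit and its single sub-problem share the name (CONVENTIONS §1), as in every Theorems file
set_option linter.dupNamespace false

namespace Summit.NavierStokesRegularity.NavierStokesRegularity.Theorems.ChiralWindowDoorZoomLambdaFrameHelpers

open MeasureTheory Set Filter Topology Metric Function
open scoped RealInnerProductSpace
open Summit.NavierStokesRegularity.NavierStokesRegularity.Theorems.ChiralWindowDoorDefs
open Summit.NavierStokesRegularity.NavierStokesRegularity.Theorems.ChiralWindowDoorLambda (lamK_mul_sq_le)
open Summit.NavierStokesRegularity.NavierStokesRegularity.Theorems.ChiralWindowDoorZoomLambdaTools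

variable {f : EuclideanSpace ℝ (Fin 3) → EuclideanSpace ℝ (Fin 3)} {y : EuclideanSpace ℝ (Fin 3)}

/-- Measurability of a shifted field `z ↦ f (y + z)`. -/
theorem aestronglyMeasurable_shift (hfm : AEStronglyMeasurable f volume) (y : EuclideanSpace ℝ (Fin 3)) :
    AEStronglyMeasurable (fun z : EuclideanSpace ℝ (Fin 3) => f (y + z)) volume :=
  hfm.comp_measurePreserving (measurePreserving_add_left volume y)

/-- Measurability of `z ↦ f (y − z)`. -/
theorem aestronglyMeasurable_shift_neg (hfm : AEStronglyMeasurable f volume) (y : EuclideanSpace ℝ (Fin 3)) :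
    AEStronglyMeasurable (fun z : EuclideanSpace ℝ (Fin 3) => f (y - z)) volume :=
  hfm.comp_measurePreserving (Measure.measurePreserving_sub_left volume y)

/-- **Integrability of the `Λ`-integrand from near and tail control**: if `‖2f(y) − f(y+z) − f(y−z)‖ ≤ A‖z‖²` for
`‖z‖ < r₀` and the shifted tails `lamK(z)‖f(y ± z)‖` are integrable off `B_{r₀}(0)`, then
`z ↦ lamK z • (2f(y) − f(y+z) − f(y−z))` is integrable on `ℝ³`. -/
theorem integrable_fracLapHalf_integrand_of_near_of_tails (hfm : AEStronglyMeasurable f volume) {r₀ A : ℝ}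
    (hr₀ : 0 < r₀) (hA : 0 ≤ A)
    (hnear : ∀ z : EuclideanSpace ℝ (Fin 3), ‖z‖ < r₀ → ‖(2 : ℝ) • f y - f (y + z) - f (y - z)‖ ≤ A * ‖z‖ ^ 2)
    (htp : IntegrableOn (fun z => lamK z * ‖f (y + z)‖) (ball (0 : EuclideanSpace ℝ (Fin 3)) r₀)ᶜ)
    (htm : IntegrableOn (fun z => lamK z * ‖f (y - z)‖) (ball (0 : EuclideanSpace ℝ (Fin 3)) r₀)ᶜ) :
    Integrable (fun z => lamK z • ((2 : ℝ) • f y - f (y + z) - f (y - z))) := by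
  set F : EuclideanSpace ℝ (Fin 3) → EuclideanSpace ℝ (Fin 3) :=
    fun z => lamK z • ((2 : ℝ) • f y - f (y + z) - f (y - z)) with hF
  have hFm : AEStronglyMeasurable F volume :=
    measurable_lamK.aestronglyMeasurable.smul
      ((aestronglyMeasurable_const.sub (aestronglyMeasurable_shift hfm y)).sub (aestronglyMeasurable_shift_neg hfm y))
  have hnF : ∀ z, ‖F z‖ = lamK z * ‖(2 : ℝ) • f y - f (y + z) - f (y - z)‖ := fun z => by
    rw [hF]; simp only; rw [norm_smul, Real.norm_eq_abs, abs_of_nonneg (lamK_nonneg z)]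
  -- near field
  have hball : IntegrableOn F (ball 0 r₀) volume := by
    refine integrableOn_ball_of_norm_le_rpow (E := EuclideanSpace ℝ (Fin 3)) (F := EuclideanSpace ℝ (Fin 3)) (μ := volume)
      (by rw [finrank_euclideanSpace_fin]; norm_num) (C := 1 / Real.pi ^ 2 * A) (α := 2) (r := r₀)
      (by rw [finrank_euclideanSpace_fin]; norm_num) ?_ hFm
    refine (ae_restrict_iff' measurableSet_ball).2 (ae_of_all _ fun z hz => ?_)
    have hz' : ‖z‖ < r₀ := by simpa [mem_ball, dist_zero_right] using hz
    rw [hnF]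
    exact (mul_le_mul_of_nonneg_left (hnear z hz') (lamK_nonneg z)).trans (lamK_mul_sq_le hA z)
  -- far field
  obtain ⟨hki, -⟩ := setIntegral_lamK_compl_ball_le hr₀
  have hfar : IntegrableOn F (ball 0 r₀)ᶜ volume := by
    have hdom : IntegrableOn (fun z => 2 * ‖f y‖ * lamK z + lamK z * ‖f (y + z)‖ + lamK z * ‖f (y - z)‖)
        (ball (0 : EuclideanSpace ℝ (Fin 3)) r₀)ᶜ := ((hki.const_mul _).add htp).add htm
    refine Integrable.mono' hdom hFm.restrict ((ae_restrict_iff' measurableSet_ball.compl).2 (ae_of_all _ fun z _ => ?_))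
    rw [hnF]
    have hK := lamK_nonneg z
    calc lamK z * ‖(2 : ℝ) • f y - f (y + z) - f (y - z)‖
        ≤ lamK z * (‖(2 : ℝ) • f y‖ + ‖f (y + z)‖ + ‖f (y - z)‖) := by
          refine mul_le_mul_of_nonneg_left ?_ hK
          calc _ ≤ ‖(2 : ℝ) • f y - f (y + z)‖ + ‖f (y - z)‖ := norm_sub_le _ _
            _ ≤ _ := by gcongr; exact norm_sub_le _ _
      _ = 2 * ‖f y‖ * lamK z + lamK z * ‖f (y + z)‖ + lamK z * ‖f (y - z)‖ := by
          rw [norm_smul, Real.norm_eq_abs, abs_of_pos (by norm_num : (0 : ℝ) < 2)]; ring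
  have h := hball.union hfar
  rwa [union_compl_self, integrableOn_univ] at h

/-- **Tails of a bounded field**: for `‖f‖ ≤ B` everywhere and `L > 0`, `z ↦ lamK(z)‖f(y+z)‖` is integrable off
`B_L(0)` with `∫_{‖z‖≥L} lamK‖f(y+z)‖ ≤ B · c/L` (`c` the packaged tail constant); the same for `y − z`. -/
theorem integrableOn_tail_of_bounded {c : ℝ} (hc : ∀ L : ℝ, 0 < L →
      (IntegrableOn lamK (ball (0 : EuclideanSpace ℝ (Fin 3)) L)ᶜ ∧
        ∫ z in (ball (0 : EuclideanSpace ℝ (Fin 3)) L)ᶜ, lamK z ≤ c / L) ∧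
      (IntegrableOn (fun z => lamK z ^ 2) (ball (0 : EuclideanSpace ℝ (Fin 3)) L)ᶜ ∧
        ∫ z in (ball (0 : EuclideanSpace ℝ (Fin 3)) L)ᶜ, lamK z ^ 2 ≤ c / L ^ 5))
    (hfm : AEStronglyMeasurable f volume) {B : ℝ} (hfB : ∀ w, ‖f w‖ ≤ B)
    (y : EuclideanSpace ℝ (Fin 3)) {L : ℝ} (hL : 0 < L) :
    (IntegrableOn (fun z => lamK z * ‖f (y + z)‖) (ball (0 : EuclideanSpace ℝ (Fin 3)) L)ᶜ ∧
      ∫ z in (ball (0 : EuclideanSpace ℝ (Fin 3)) L)ᶜ, lamK z * ‖f (y + z)‖ ≤ B * (c / L)) ∧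
    (IntegrableOn (fun z => lamK z * ‖f (y - z)‖) (ball (0 : EuclideanSpace ℝ (Fin 3)) L)ᶜ ∧
      ∫ z in (ball (0 : EuclideanSpace ℝ (Fin 3)) L)ᶜ, lamK z * ‖f (y - z)‖ ≤ B * (c / L)) := by
  obtain ⟨⟨hki, hkv⟩, -⟩ := hc L hL
  have hB : 0 ≤ B := (norm_nonneg _).trans (hfB 0)
  have hdomi : IntegrableOn (fun z => B * lamK z) (ball (0 : EuclideanSpace ℝ (Fin 3)) L)ᶜ := hki.const_mul B
  have key : ∀ g : EuclideanSpace ℝ (Fin 3) → EuclideanSpace ℝ (Fin 3), AEStronglyMeasurable g volume →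
      (∀ z, ‖g z‖ ≤ B) →
      IntegrableOn (fun z => lamK z * ‖g z‖) (ball (0 : EuclideanSpace ℝ (Fin 3)) L)ᶜ ∧
        ∫ z in (ball (0 : EuclideanSpace ℝ (Fin 3)) L)ᶜ, lamK z * ‖g z‖ ≤ B * (c / L) := by
    intro g hgm hgB
    have hdom : ∀ z, ‖lamK z * ‖g z‖‖ ≤ B * lamK z := fun z => by
      rw [Real.norm_eq_abs, abs_of_nonneg (mul_nonneg (lamK_nonneg z) (norm_nonneg _)), mul_comm]
      exact mul_le_mul_of_nonneg_right (hgB z) (lamK_nonneg z)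
    have hint : IntegrableOn (fun z => lamK z * ‖g z‖) (ball (0 : EuclideanSpace ℝ (Fin 3)) L)ᶜ :=
      Integrable.mono' hdomi (measurable_lamK.aestronglyMeasurable.mul hgm.norm).restrict (ae_of_all _ hdom)
    refine ⟨hint, ?_⟩
    calc ∫ z in (ball (0 : EuclideanSpace ℝ (Fin 3)) L)ᶜ, lamK z * ‖g z‖
        ≤ ∫ z in (ball (0 : EuclideanSpace ℝ (Fin 3)) L)ᶜ, B * lamK z :=
          setIntegral_mono_on hint hdomi measurableSet_ball.compl fun z _ =>
            (le_abs_self _).trans ((Real.norm_eq_abs _).symm.le.trans (hdom z))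
      _ = B * ∫ z in (ball (0 : EuclideanSpace ℝ (Fin 3)) L)ᶜ, lamK z := integral_const_mul _ _
      _ ≤ _ := mul_le_mul_of_nonneg_left hkv hB
  exact ⟨key _ (aestronglyMeasurable_shift hfm y) fun z => hfB _,
    key _ (aestronglyMeasurable_shift_neg hfm y) fun z => hfB _⟩

/-- **`L²` mass of a zoomed slice**: `∫‖c • g(x₀ + μ w)‖² dw = c² (μ³)⁻¹ ∫‖g‖²` for `μ > 0`, with integrability. -/
theorem integral_normSq_zoomSlice {g : EuclideanSpace ℝ (Fin 3) → EuclideanSpace ℝ (Fin 3)}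
    (hg : Integrable (fun x => ‖g x‖ ^ 2)) (c : ℝ) {μ : ℝ} (hμ : 0 < μ) (x₀ : EuclideanSpace ℝ (Fin 3)) :
    Integrable (fun w : EuclideanSpace ℝ (Fin 3) => ‖c • g (x₀ + μ • w)‖ ^ 2) ∧
      ∫ w : EuclideanSpace ℝ (Fin 3), ‖c • g (x₀ + μ • w)‖ ^ 2 = c ^ 2 * (μ ^ 3)⁻¹ * ∫ x, ‖g x‖ ^ 2 := by
  set G : EuclideanSpace ℝ (Fin 3) → ℝ := fun x => ‖g (x₀ + x)‖ ^ 2 with hG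
  have hGi : Integrable G := hg.comp_add_left x₀
  have hGv : ∫ x, G x = ∫ x, ‖g x‖ ^ 2 := integral_add_left_eq_self (fun x => ‖g x‖ ^ 2) x₀
  have hGs : Integrable (fun w : EuclideanSpace ℝ (Fin 3) => G (μ • w)) := hGi.comp_smul hμ.ne'
  have hpt : ∀ w : EuclideanSpace ℝ (Fin 3), ‖c • g (x₀ + μ • w)‖ ^ 2 = c ^ 2 * G (μ • w) := fun w => by
    rw [hG]; simp only; rw [norm_smul, mul_pow, Real.norm_eq_abs, sq_abs]
  simp_rw [hpt]
  refine ⟨hGs.const_mul _, ?_⟩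
  rw [integral_const_mul, Measure.integral_comp_smul volume G μ, finrank_euclideanSpace_fin,
    abs_of_pos (inv_pos.2 (pow_pos hμ 3)), smul_eq_mul, hGv]
  ring

/-- `‖f‖²` integrable ⇒ `‖f ∘ neg‖²` integrable, with the same integral. -/
theorem integrable_normSq_comp_neg (hf2 : Integrable (fun w => ‖f w‖ ^ 2)) :
    Integrable (fun w : EuclideanSpace ℝ (Fin 3) => ‖f (-w)‖ ^ 2) ∧
      ∫ w : EuclideanSpace ℝ (Fin 3), ‖f (-w)‖ ^ 2 = ∫ w, ‖f w‖ ^ 2 := by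
  refine ⟨?_, integral_neg_eq_self (fun w => ‖f w‖ ^ 2) volume⟩
  have h := hf2.comp_smul (R := (-1 : ℝ)) (by norm_num)
  simpa using h

/-- **The `y − z` tail from the `y + z` lemma** (apply `integral_tail_shift_le` to `f ∘ neg` at `−y`). -/
theorem integral_tail_shift_neg_le {c : ℝ} (hc : ∀ L : ℝ, 0 < L →
      (IntegrableOn lamK (ball (0 : EuclideanSpace ℝ (Fin 3)) L)ᶜ ∧
        ∫ z in (ball (0 : EuclideanSpace ℝ (Fin 3)) L)ᶜ, lamK z ≤ c / L) ∧
      (IntegrableOn (fun z => lamK z ^ 2) (ball (0 : EuclideanSpace ℝ (Fin 3)) L)ᶜ ∧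
        ∫ z in (ball (0 : EuclideanSpace ℝ (Fin 3)) L)ᶜ, lamK z ^ 2 ≤ c / L ^ 5))
    (hfm : AEStronglyMeasurable f volume)
    {B P E : ℝ} (hB : 0 ≤ B) (hfB : ∀ w, ‖w‖ < P → ‖f w‖ ≤ B) (hf2 : Integrable (fun w => ‖f w‖ ^ 2))
    (hE : ∫ w, ‖f w‖ ^ 2 ≤ E) (hy : ‖y‖ < P) {L₀ : ℝ} (hL₀ : 0 < L₀) :
    IntegrableOn (fun z => lamK z * ‖f (y - z)‖) (ball (0 : EuclideanSpace ℝ (Fin 3)) L₀)ᶜ ∧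
      ∫ z in (ball (0 : EuclideanSpace ℝ (Fin 3)) L₀)ᶜ, lamK z * ‖f (y - z)‖ ≤
        B * (c / L₀) + ((P - ‖y‖) ^ 3 * (c / (P - ‖y‖) ^ 5) + ((P - ‖y‖) ^ 3)⁻¹ * E) / 2 := by
  set g : EuclideanSpace ℝ (Fin 3) → EuclideanSpace ℝ (Fin 3) := fun w => f (-w) with hg
  have hgm : AEStronglyMeasurable g volume := hfm.comp_measurePreserving (Measure.measurePreserving_neg volume)
  have hgB : ∀ w, ‖w‖ < P → ‖g w‖ ≤ B := fun w hw => hfB (-w) (by rwa [norm_neg])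
  obtain ⟨hg2, hg2v⟩ := integrable_normSq_comp_neg hf2
  have hgE : ∫ w, ‖g w‖ ^ 2 ≤ E := by rw [hg]; simp only; rw [hg2v]; exact hE
  have hy' : ‖-y‖ < P := by rwa [norm_neg]
  obtain ⟨hi, hv⟩ := integral_tail_shift_le hc hgm hB hgB hg2 hgE hy' hL₀
  have e : (fun z => lamK z * ‖g (-y + z)‖) = fun z => lamK z * ‖f (y - z)‖ := by
    funext z; rw [hg]; simp only; rw [neg_add, neg_neg, sub_eq_add_neg]
  rw [e] at hi hv
  rw [norm_neg] at hv
  exact ⟨hi, hv⟩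

/-! ### Splitting a second difference under the kernel; the tail estimate it yields -/

/-- `lamK(z)‖2f(y) − f(y+z) − f(y−z)‖ ≤ 2‖f y‖ lamK z + lamK z ‖f(y+z)‖ + lamK z ‖f(y−z)‖`. -/
theorem lamK_mul_norm_secondDiff_le (f : EuclideanSpace ℝ (Fin 3) → EuclideanSpace ℝ (Fin 3))
    (y z : EuclideanSpace ℝ (Fin 3)) :
    lamK z * ‖(2 : ℝ) • f y - f (y + z) - f (y - z)‖ ≤
      2 * ‖f y‖ * lamK z + lamK z * ‖f (y + z)‖ + lamK z * ‖f (y - z)‖ := by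
  have hK := lamK_nonneg z
  calc lamK z * ‖(2 : ℝ) • f y - f (y + z) - f (y - z)‖
      ≤ lamK z * (‖(2 : ℝ) • f y‖ + ‖f (y + z)‖ + ‖f (y - z)‖) := by
        refine mul_le_mul_of_nonneg_left ?_ hK
        calc _ ≤ ‖(2 : ℝ) • f y - f (y + z)‖ + ‖f (y - z)‖ := norm_sub_le _ _
          _ ≤ _ := by gcongr; exact norm_sub_le _ _
    _ = 2 * ‖f y‖ * lamK z + lamK z * ‖f (y + z)‖ + lamK z * ‖f (y - z)‖ := by
        rw [norm_smul, Real.norm_eq_abs, abs_of_pos (by norm_num : (0 : ℝ) < 2)]; ring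

/-- **Tail of the `Λ`-integrand from the two shifted tails**: if `‖f y‖ ≤ B` and
`∫_{‖z‖≥L₀} lamK‖f(y ± z)‖ ≤ B c/L₀ + o`, then `∫_{‖z‖≥L₀} lamK‖2f(y) − f(y+z) − f(y−z)‖ ≤ 4B c/L₀ + 2o`. -/
theorem setIntegral_tail_secondDiff_le {c : ℝ} (hc : ∀ L : ℝ, 0 < L →
      (IntegrableOn lamK (ball (0 : EuclideanSpace ℝ (Fin 3)) L)ᶜ ∧
        ∫ z in (ball (0 : EuclideanSpace ℝ (Fin 3)) L)ᶜ, lamK z ≤ c / L) ∧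
      (IntegrableOn (fun z => lamK z ^ 2) (ball (0 : EuclideanSpace ℝ (Fin 3)) L)ᶜ ∧
        ∫ z in (ball (0 : EuclideanSpace ℝ (Fin 3)) L)ᶜ, lamK z ^ 2 ≤ c / L ^ 5))
    {L₀ B o : ℝ} (hL₀ : 0 < L₀)
    (hfi : Integrable (fun z => lamK z • ((2 : ℝ) • f y - f (y + z) - f (y - z)))) (hfy : ‖f y‖ ≤ B)
    (htp : IntegrableOn (fun z => lamK z * ‖f (y + z)‖) (ball (0 : EuclideanSpace ℝ (Fin 3)) L₀)ᶜ ∧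
      ∫ z in (ball (0 : EuclideanSpace ℝ (Fin 3)) L₀)ᶜ, lamK z * ‖f (y + z)‖ ≤ B * (c / L₀) + o)
    (htm : IntegrableOn (fun z => lamK z * ‖f (y - z)‖) (ball (0 : EuclideanSpace ℝ (Fin 3)) L₀)ᶜ ∧
      ∫ z in (ball (0 : EuclideanSpace ℝ (Fin 3)) L₀)ᶜ, lamK z * ‖f (y - z)‖ ≤ B * (c / L₀) + o) :
    ∫ z in (ball (0 : EuclideanSpace ℝ (Fin 3)) L₀)ᶜ, lamK z * ‖(2 : ℝ) • f y - f (y + z) - f (y - z)‖ ≤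
      4 * B * (c / L₀) + 2 * o := by
  obtain ⟨⟨hki, hkv⟩, -⟩ := hc L₀ hL₀
  have hB0 : 0 ≤ B := (norm_nonneg _).trans hfy
  have hcL : 0 ≤ c / L₀ := le_trans (integral_nonneg fun z => lamK_nonneg z) hkv
  have hlhs : IntegrableOn (fun z => lamK z * ‖(2 : ℝ) • f y - f (y + z) - f (y - z)‖)
      (ball (0 : EuclideanSpace ℝ (Fin 3)) L₀)ᶜ := by
    refine (hfi.norm.integrableOn).congr_fun (fun z _ => ?_) measurableSet_ball.compl
    dsimp only
    rw [norm_smul, Real.norm_eq_abs, abs_of_nonneg (lamK_nonneg z)]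
  have h12 : IntegrableOn (fun z => 2 * ‖f y‖ * lamK z + lamK z * ‖f (y + z)‖)
      (ball (0 : EuclideanSpace ℝ (Fin 3)) L₀)ᶜ := (hki.const_mul _).add htp.1
  have hrhs : IntegrableOn (fun z => 2 * ‖f y‖ * lamK z + lamK z * ‖f (y + z)‖ + lamK z * ‖f (y - z)‖)
      (ball (0 : EuclideanSpace ℝ (Fin 3)) L₀)ᶜ := h12.add htm.1
  have hk1 : IntegrableOn (fun z => 2 * ‖f y‖ * lamK z) (ball (0 : EuclideanSpace ℝ (Fin 3)) L₀)ᶜ := hki.const_mul _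
  have hsum : ∫ z in (ball (0 : EuclideanSpace ℝ (Fin 3)) L₀)ᶜ,
      (2 * ‖f y‖ * lamK z + lamK z * ‖f (y + z)‖ + lamK z * ‖f (y - z)‖) =
      2 * ‖f y‖ * (∫ z in (ball (0 : EuclideanSpace ℝ (Fin 3)) L₀)ᶜ, lamK z) +
        (∫ z in (ball (0 : EuclideanSpace ℝ (Fin 3)) L₀)ᶜ, lamK z * ‖f (y + z)‖) +
        ∫ z in (ball (0 : EuclideanSpace ℝ (Fin 3)) L₀)ᶜ, lamK z * ‖f (y - z)‖ := by
    rw [integral_add h12 htm.1, integral_add hk1 htp.1, integral_const_mul]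
  have h1 : 2 * ‖f y‖ * (∫ z in (ball (0 : EuclideanSpace ℝ (Fin 3)) L₀)ᶜ, lamK z) ≤ 2 * B * (c / L₀) :=
    mul_le_mul (by linarith) hkv (integral_nonneg fun z => lamK_nonneg z) (by positivity)
  calc ∫ z in (ball (0 : EuclideanSpace ℝ (Fin 3)) L₀)ᶜ, lamK z * ‖(2 : ℝ) • f y - f (y + z) - f (y - z)‖
      ≤ ∫ z in (ball (0 : EuclideanSpace ℝ (Fin 3)) L₀)ᶜ,
          (2 * ‖f y‖ * lamK z + lamK z * ‖f (y + z)‖ + lamK z * ‖f (y - z)‖) :=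
        setIntegral_mono_on hlhs hrhs measurableSet_ball.compl fun z _ => lamK_mul_norm_secondDiff_le f y z
    _ ≤ 4 * B * (c / L₀) + 2 * o := by rw [hsum]; linarith [htp.2, htm.2]

/-! ### The far-field error is `O(μ²)` -/

/-- **Far-field bookkeeping**: with `P = ρ/(2μ)` and `μ(‖y‖+1) ≤ ρ/4`, `L = P − ‖y‖ ≥ ρ/(4μ)`, so
`L³ (c/L⁵) + L⁻³ · ((μ/ν)² μ⁻³ E₀) ≤ (16c/ρ² + 64E₀/(ν²ρ³)) μ²`. -/
theorem far_error_le {c E₀ ν ρ μ n : ℝ} (hc : 0 ≤ c) (hE : 0 ≤ E₀) (hν : 0 < ν) (hρ : 0 < ρ) (hμ : 0 < μ)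
    (hsmall : μ * (n + 1) ≤ ρ / 4) :
    n < ρ / (2 * μ) ∧
      (ρ / (2 * μ) - n) ^ 3 * (c / (ρ / (2 * μ) - n) ^ 5) + ((ρ / (2 * μ) - n) ^ 3)⁻¹ * ((μ / ν) ^ 2 * (μ ^ 3)⁻¹ * E₀) ≤
        (16 * c / ρ ^ 2 + 64 * E₀ / (ν ^ 2 * ρ ^ 3)) * μ ^ 2 := by
  have hyμ : n ≤ ρ / (4 * μ) := by
    rw [le_div_iff₀ (by positivity)]; nlinarith
  have hq : 0 < ρ / (4 * μ) := by positivity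
  have hL : ρ / (4 * μ) ≤ ρ / (2 * μ) - n := by
    have e : ρ / (2 * μ) - ρ / (4 * μ) = ρ / (4 * μ) := by field_simp; ring
    linarith
  set L : ℝ := ρ / (2 * μ) - n with hLdef
  have hLpos : 0 < L := lt_of_lt_of_le hq hL
  refine ⟨by linarith, ?_⟩
  have hfac : 0 ≤ (μ / ν) ^ 2 * (μ ^ 3)⁻¹ * E₀ :=
    mul_nonneg (mul_nonneg (sq_nonneg _) (inv_nonneg.2 (pow_nonneg hμ.le 3))) hE
  have hA : L ^ 3 * (c / L ^ 5) = c / L ^ 2 := by field_simp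
  have hA' : c / L ^ 2 ≤ c / (ρ / (4 * μ)) ^ 2 :=
    div_le_div_of_nonneg_left hc (by positivity) (pow_le_pow_left₀ hq.le hL 2)
  have hA'' : c / (ρ / (4 * μ)) ^ 2 = 16 * c / ρ ^ 2 * μ ^ 2 := by field_simp; ring
  have hB' : (L ^ 3)⁻¹ * ((μ / ν) ^ 2 * (μ ^ 3)⁻¹ * E₀) ≤ ((ρ / (4 * μ)) ^ 3)⁻¹ * ((μ / ν) ^ 2 * (μ ^ 3)⁻¹ * E₀) :=
    mul_le_mul_of_nonneg_right (inv_anti₀ (by positivity) (pow_le_pow_left₀ hq.le hL 3)) hfac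
  have hB'' : ((ρ / (4 * μ)) ^ 3)⁻¹ * ((μ / ν) ^ 2 * (μ ^ 3)⁻¹ * E₀) = 64 * E₀ / (ν ^ 2 * ρ ^ 3) * μ ^ 2 := by
    field_simp; ring
  calc L ^ 3 * (c / L ^ 5) + (L ^ 3)⁻¹ * ((μ / ν) ^ 2 * (μ ^ 3)⁻¹ * E₀)
      = c / L ^ 2 + (L ^ 3)⁻¹ * ((μ / ν) ^ 2 * (μ ^ 3)⁻¹ * E₀) := by rw [hA]
    _ ≤ 16 * c / ρ ^ 2 * μ ^ 2 + 64 * E₀ / (ν ^ 2 * ρ ^ 3) * μ ^ 2 := by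
        rw [← hA'', ← hB'']; exact add_le_add hA' hB'
    _ = (16 * c / ρ ^ 2 + 64 * E₀ / (ν ^ 2 * ρ ^ 3)) * μ ^ 2 := by ring

end Summit.NavierStokesRegularity.NavierStokesRegularity.Theorems.ChiralWindowDoorZoomLambdaFrameHelpers

end
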